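import Summits.CriticalPhenomena.PercolationContinuityZ3.Theses.PercNearOneGluing
import Literature.Probability.Percolation.PercolationProofs
import Literature.Probability.Percolation.ConditionalPositiveAssociationProofs
import Literature.Probability.Percolation.TwoClusterConditionalAssociationProofs

/-! TTRL-lite variant V1342 of stmt-CriticalPhenomena-4576 -/

namespace Summit.CriticalPhenomena.PercolationContinuityZ3.Theorems

open MeasureTheory Literature.Probability.LatticeModels Literature.Probability.Percolation
open scoped Classical BigOperators

/-- TTRL-lite variant V1342 (selftest): the reflexive connection event `{o ↔ o}` is the sure
event, so it has `prodBernoulli w`-probability one. -/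
theorem goodstep_var1342 :
    ∀ (n : ℕ) (w : Sym2 (Fin n) → unitInterval) (o : Fin n),
      (prodBernoulli w).real (openConn o o) = 1 := by
  intro n w o
  have h : openConn o o = (Set.univ : Set (BondConfig (Fin n))) :=
    Set.eq_univ_of_forall fun _ => SimpleGraph.Reachable.refl _
  rw [h, probReal_univ]

end Summit.CriticalPhenomena.PercolationContinuityZ3.Theorems
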